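import Summits.AtomisticToContinuum.Crystallization.Theses.PalmUnimodularRigidity
import Summits.AtomisticToContinuum.Crystallization.Theorems.MinimiserShells.Negative.LoadBearing
import Summits.AtomisticToContinuum.Crystallization.Theorems.MinimiserShells.Negative.Rootedness
import Summits.AtomisticToContinuum.Crystallization.Theorems.PalmUnimodularRigidityMinimiserShellsEquilibriumInLawCellSums
import Literature.Probability.Process.PointStationaryLaw
import Literature.MathematicalPhysics.StatisticalMechanics.RootEnergy
import Literature.MathematicalPhysics.StatisticalMechanics.MuGSC

/-!
# Assembly: every gain event has probability zero under a minimising point-stationary law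

Helper file for stub `stub_equilibriumInLaw` (S1) of line `equilibrium-in-law-surgery`, crux
`MinimiserShells` (stmt-AtomisticToContinuum-9225): blueprint lemma 11.

`measure_gainEvent_eq_zero`: for `δ > 0`, a probability law `P` on rooted `δ`-hard-core
configurations which is point-stationary and minimising (`E_P[h] ≤ e*`), and every modification
type `(n₀, k, r, ε, R')`, the event `{μ | gainCount n₀ k r ε R' μ ≠ 0}` is `P`-null.
Proof (cluster periodisation): integrate the pointwise cell inequality
`ofReal(e* + B)·vol(cube) + ofReal(c)·cellAvg F₃ ≤ cellAvg F₁ + cellAvg F₂` (`pointwise_cell_inequality`)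
against `P` and evaluate the three cell averages by the cell-average identity
(`lintegral_cellAvg_eq`): `∫ cellAvg F₁ = L³ ∫ ofReal(h + B) ≤ L³ ofReal(e* + B)` (minimising),
`∫ cellAvg F₂ = ∫_cube ofReal(tailBound ⌊depth⌋) ≤ 6 CT L²` (thin boundary layers),
`∫ cellAvg F₃ = P(E) · vol{deep phases} ≥ P(E)(L³ − 6 R₀ L²)`; hence
`P(E) · c L³ ≤ (6 CT + 6 c R₀) L²` for every `L > 0`, and `P(E) = 0`.
The hypothesis `UnimodularEnergyLowerBound` (item 9229) is not needed.
-/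

noncomputable section

open MeasureTheory ProbabilityTheory
open scoped ENNReal BigOperators

namespace Summit.AtomisticToContinuum.Crystallization.Theorems.PalmUnimodularRigidityMinimiserShells.EquilibriumInLaw.Assembly

open Literature.Probability.Process (IsPointStationaryLaw IsRootedHardCore count_restrict_singleton_ne_zero_iff
  map_sub_count_restrict)
open Literature.MathematicalPhysics.StatisticalMechanics (lennardJones IsMuGSC UniformlyDiscrete)
open Summit.AtomisticToContinuum.Crystallization.Theses.PalmUnimodularRigidity (MinimiserShells UnimodularEnergyLowerBound)
open Summit.AtomisticToContinuum.Crystallization.Theorems.MinimiserShells.Negative.LoadBearing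
  (eStar meanRootEnergy GoodShell minimiserShells_iff)
open Summit.AtomisticToContinuum.Crystallization.Theorems.MinimiserShells.Negative.Rootedness (E3
  countable_of_separated)
open Summit.AtomisticToContinuum.Crystallization.Theorems.PalmUnimodularRigidityMinimiserShells.EquilibriumInLaw.LfKernel
  (lfKernel lfKernel_count_restrict)
open Summit.AtomisticToContinuum.Crystallization.Theorems.PalmUnimodularRigidityMinimiserShells.EquilibriumInLaw.GainEvent
  (gainCount measurableSet_gainCount_ne_zero)
open Summit.AtomisticToContinuum.Crystallization.Theorems.PalmUnimodularRigidityMinimiserShells.EquilibriumInLaw.Phase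
  (cube depth measurableSet_cube measurable_depth depth_nonneg)
open Summit.AtomisticToContinuum.Crystallization.Theorems.PalmUnimodularRigidityMinimiserShells.EquilibriumInLaw.Lattice
  (volume_cube volume_depth_mem_Icc_le)
open Summit.AtomisticToContinuum.Crystallization.Theorems.PalmUnimodularRigidityMinimiserShells.EquilibriumInLaw.RootSums
  (Bδ Bδ_nonneg tailBound tailBound_nonneg CT CT_nonneg tsum_ofReal_tailBound_le abs_integral_norm_le)
open Summit.AtomisticToContinuum.Crystallization.Theorems.PalmUnimodularRigidityMinimiserShells.EquilibriumInLaw.CellAverage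
  (cellAvg measurable_cellAvg lintegral_cellAvg_eq)
open Summit.AtomisticToContinuum.Crystallization.Theorems.PalmUnimodularRigidityMinimiserShells.EquilibriumInLaw.CellSums
  (hTilde measurable_hTilde hTilde_eq Bshift F₁ F₂ F₃ measurable_F₁ measurable_F₂ measurable_F₃
  F₁_periodic F₂_periodic F₃_periodic pointwise_cell_inequality)

/-! ## Evaluating the three phase integrals -/

/-- The phase integral of the depth penalty is `O(L²)`: `∫_{cube} ofReal(tailBound δ ⌊depth⌋) ≤ 6L² · CT`. -/
theorem setLIntegral_F₂_le {δ L : ℝ} (hL : 0 < L) (μ : Measure E3) :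
    ∫⁻ u in cube L, F₂ δ L μ u ≤ ENNReal.ofReal (6 * L ^ 2) * ENNReal.ofReal (CT δ) := by
  have hN : Measurable fun u : E3 => ⌊depth L u⌋₊ := Nat.measurable_floor.comp (measurable_depth L)
  set T : ℕ → Set E3 := fun j => {u : E3 | ⌊depth L u⌋₊ = j} with hT
  have hset : ∀ j : ℕ, MeasurableSet (T j) := fun j => hN (measurableSet_singleton j)
  -- pointwise decomposition along the integer depth
  have hpt : ∀ u : E3, F₂ δ L μ u = ∑' j : ℕ, (T j).indicator (fun _ => ENNReal.ofReal (tailBound δ j)) u := by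
    intro u
    rw [tsum_eq_single ⌊depth L u⌋₊]
    · have hu : u ∈ T ⌊depth L u⌋₊ := rfl
      rw [Set.indicator_of_mem hu]
      rfl
    · intro j hj
      have hu : u ∉ T j := fun h => hj (Eq.symm h)
      exact Set.indicator_of_notMem hu _
  have hvol : ∀ j : ℕ, (volume.restrict (cube L)) (T j) ≤ ENNReal.ofReal (6 * L ^ 2) := by
    intro j
    rw [Measure.restrict_apply (hset j)]
    calc volume (T j ∩ cube L)
        ≤ volume {u : E3 | u ∈ cube L ∧ depth L u ∈ Set.Icc (j : ℝ) (j + 1)} := by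
          refine measure_mono ?_
          rintro u ⟨hu, hc⟩
          have hfl := (Nat.floor_eq_iff (depth_nonneg hL.le u)).1 hu
          exact ⟨hc, hfl.1, hfl.2.le⟩
      _ ≤ ENNReal.ofReal (6 * ((j : ℝ) + 1 - j) * L ^ 2) := volume_depth_mem_Icc_le hL (by linarith)
      _ = ENNReal.ofReal (6 * L ^ 2) := by ring_nf
  calc ∫⁻ u in cube L, F₂ δ L μ u
      = ∫⁻ u in cube L, ∑' j : ℕ, (T j).indicator (fun _ => ENNReal.ofReal (tailBound δ j)) u :=
        lintegral_congr hpt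
    _ = ∑' j : ℕ, ∫⁻ u in cube L, (T j).indicator (fun _ => ENNReal.ofReal (tailBound δ j)) u :=
        lintegral_tsum fun j => (measurable_const.indicator (hset j)).aemeasurable
    _ = ∑' j : ℕ, ENNReal.ofReal (tailBound δ j) * (volume.restrict (cube L)) (T j) :=
        tsum_congr fun j => lintegral_indicator_const (hset j) _
    _ ≤ ∑' j : ℕ, ENNReal.ofReal (tailBound δ j) * ENNReal.ofReal (6 * L ^ 2) :=
        ENNReal.tsum_le_tsum fun j => mul_le_mul' le_rfl (hvol j)
    _ = (∑' j : ℕ, ENNReal.ofReal (tailBound δ j)) * ENNReal.ofReal (6 * L ^ 2) := ENNReal.tsum_mul_right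
    _ ≤ ENNReal.ofReal (CT δ) * ENNReal.ofReal (6 * L ^ 2) := mul_le_mul' (tsum_ofReal_tailBound_le δ) le_rfl
    _ = ENNReal.ofReal (6 * L ^ 2) * ENNReal.ofReal (CT δ) := mul_comm _ _

/-- Most phases are deep: `vol(cube) ≤ vol{u ∈ cube | R₀ < depth u} + 6 R₀ L²`. -/
theorem volume_cube_le_deep_add {L R₀ : ℝ} (hL : 0 < L) (hR₀ : 0 ≤ R₀) :
    volume (cube L) ≤ (volume.restrict (cube L)) {u : E3 | R₀ < depth L u} + ENNReal.ofReal (6 * R₀ * L ^ 2) := by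
  have hm : MeasurableSet {u : E3 | R₀ < depth L u} := measurableSet_lt measurable_const (measurable_depth L)
  rw [Measure.restrict_apply hm]
  calc volume (cube L) ≤ volume (({u : E3 | R₀ < depth L u} ∩ cube L) ∪
        {u : E3 | u ∈ cube L ∧ depth L u ∈ Set.Icc 0 R₀}) := by
          refine measure_mono fun u hu => ?_
          by_cases h : R₀ < depth L u
          · exact Or.inl ⟨h, hu⟩
          · exact Or.inr ⟨hu, depth_nonneg hL.le u, not_lt.1 h⟩
    _ ≤ volume ({u : E3 | R₀ < depth L u} ∩ cube L) + volume {u : E3 | u ∈ cube L ∧ depth L u ∈ Set.Icc 0 R₀} :=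
        measure_union_le _ _
    _ ≤ volume ({u : E3 | R₀ < depth L u} ∩ cube L) + ENNReal.ofReal (6 * R₀ * L ^ 2) := by
        gcongr
        have := volume_depth_mem_Icc_le (L := L) hL hR₀
        rwa [sub_zero] at this

/-! ## The three expectations -/

/-- `E[cellAvg F₁] = vol(cube) · ∫ ofReal(hTilde + B) dP`. -/
theorem lintegral_cellAvg_F₁ {δ L : ℝ} (hL : 0 < L) (hδ : 0 < δ) {P : Measure (Measure E3)}
    (hcore : ∀ᵐ μ ∂P, IsRootedHardCore δ μ) (hstat : IsPointStationaryLaw P) :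
    ∫⁻ μ, cellAvg L (F₁ δ) μ ∂P = (∫⁻ μ, ENNReal.ofReal (hTilde μ + Bshift δ) ∂P) * volume (cube L) := by
  have hm : Measurable fun μ : Measure E3 => ENNReal.ofReal (hTilde μ + Bshift δ) :=
    ENNReal.measurable_ofReal.comp (measurable_hTilde.add_const _)
  rw [lintegral_cellAvg_eq hL hδ hcore hstat (measurable_F₁ δ) (F₁_periodic δ hL.ne'), ← lintegral_mul_const _ hm]
  refine lintegral_congr fun μ => ?_
  exact setLIntegral_const _ _

/-- `E[cellAvg F₂] = ∫_{cube} ofReal(tailBound δ ⌊depth⌋)`. -/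
theorem lintegral_cellAvg_F₂ {δ L : ℝ} (hL : 0 < L) (hδ : 0 < δ) {P : Measure (Measure E3)} [IsProbabilityMeasure P]
    (hcore : ∀ᵐ μ ∂P, IsRootedHardCore δ μ) (hstat : IsPointStationaryLaw P) :
    ∫⁻ μ, cellAvg L (F₂ δ L) μ ∂P = ∫⁻ u in cube L, F₂ δ L (0 : Measure E3) u := by
  rw [lintegral_cellAvg_eq hL hδ hcore hstat (measurable_F₂ δ L) (F₂_periodic δ hL.ne')]
  have : ∀ μ : Measure E3, (∫⁻ u in cube L, F₂ δ L μ u) = ∫⁻ u in cube L, F₂ δ L (0 : Measure E3) u := fun _ => rfl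
  simp_rw [this]
  rw [lintegral_const, measure_univ, mul_one]

/-- `E[cellAvg F₃] = P(E) · vol{u ∈ cube | R₀ < depth u}`. -/
theorem lintegral_cellAvg_F₃ {δ L : ℝ} (hL : 0 < L) (hδ : 0 < δ) {P : Measure (Measure E3)}
    (hcore : ∀ᵐ μ ∂P, IsRootedHardCore δ μ) (hstat : IsPointStationaryLaw P)
    (R₀ : ℝ) (n₀ k : ℕ) (r ε : ℝ) (R' : Fin k → E3) :
    ∫⁻ μ, cellAvg L (F₃ L R₀ n₀ k r ε R') μ ∂P =
      P {μ : Measure E3 | gainCount n₀ k r ε R' μ ≠ 0} * (volume.restrict (cube L)) {u : E3 | R₀ < depth L u} := by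
  have hEm := measurableSet_gainCount_ne_zero n₀ k r ε R'
  have hm : MeasurableSet {u : E3 | R₀ < depth L u} := measurableSet_lt measurable_const (measurable_depth L)
  rw [lintegral_cellAvg_eq hL hδ hcore hstat (measurable_F₃ L R₀ n₀ k r ε R') (F₃_periodic hL.ne' R₀ n₀ k r ε R')]
  have hinner : ∀ μ : Measure E3, (∫⁻ u in cube L, F₃ L R₀ n₀ k r ε R' μ u) =
      {μ : Measure E3 | gainCount n₀ k r ε R' μ ≠ 0}.indicator 1 μ *
        (volume.restrict (cube L)) {u : E3 | R₀ < depth L u} := by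
    intro μ
    unfold F₃
    rw [lintegral_const_mul _ (measurable_one.indicator hm), lintegral_indicator_one hm]
  simp_rw [hinner]
  rw [lintegral_mul_const _ (measurable_one.indicator hEm), lintegral_indicator_one hEm]

/-! ## The root energy: integrability and the minimising bound -/

/-- Under a minimising law, `∫ ofReal(hTilde + Bshift) dP ≤ ofReal(e* + Bshift)`. -/
theorem lintegral_ofReal_hTilde_le {δ : ℝ} (hδ : 0 < δ) {P : Measure (Measure E3)} [IsProbabilityMeasure P]
    (hcore : ∀ᵐ μ ∂P, IsRootedHardCore δ μ) (hE : meanRootEnergy P ≤ eStar) :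
    ∫⁻ μ, ENNReal.ofReal (hTilde μ + Bshift δ) ∂P ≤ ENNReal.ofReal (eStar + Bshift δ) := by
  set h : Measure E3 → ℝ := fun μ => (∫ z, lennardJones ‖z‖ ∂μ) / 2 with hh
  have hh_ae : ∀ᵐ μ ∂P, hTilde μ = h μ := by
    filter_upwards [hcore] with μ hμ
    obtain ⟨S, -, hsep, rfl⟩ := hμ
    exact hTilde_eq (lfKernel_count_restrict hδ hsep)
  have hbound : ∀ᵐ μ ∂P, ‖h μ‖ ≤ Bδ δ / 2 := by
    filter_upwards [hcore] with μ hμ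
    obtain ⟨S, h0, hsep, rfl⟩ := hμ
    have := abs_integral_norm_le hδ h0 hsep
    rw [Real.norm_eq_abs, hh]
    simp only [abs_div, abs_two]
    linarith
  have hasm : AEStronglyMeasurable h P :=
    (measurable_hTilde.aestronglyMeasurable : AEStronglyMeasurable hTilde P).congr hh_ae
  have hint : Integrable h P := Integrable.of_bound hasm (Bδ δ / 2) hbound
  have hnn : 0 ≤ᵐ[P] fun μ => h μ + Bshift δ := by
    filter_upwards [hbound] with μ hμ
    rw [Real.norm_eq_abs, abs_le] at hμ
    simp only [Pi.zero_apply, Bshift]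
    have := abs_nonneg eStar
    linarith [hμ.1]
  have hint' : Integrable (fun μ => h μ + Bshift δ) P := hint.add (integrable_const _)
  have h1 : ∫⁻ μ, ENNReal.ofReal (hTilde μ + Bshift δ) ∂P = ∫⁻ μ, ENNReal.ofReal (h μ + Bshift δ) ∂P :=
    lintegral_congr_ae (hh_ae.mono fun μ hμ => by simp only [hμ])
  have hEh : ∫ μ, h μ ∂P = meanRootEnergy P := rfl
  rw [h1, ← ofReal_integral_eq_lintegral_ofReal hint' hnn, integral_add hint (integrable_const _),
    integral_const, smul_eq_mul, probReal_univ, one_mul, hEh]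
  exact ENNReal.ofReal_le_ofReal (by linarith)

/-! ## The key inequality and the conclusion -/

/-- **The key inequality**: for every grid size `L > 0`,
`P(E) · ofReal(c L³) ≤ ofReal((6 CT + 6 c R₀) L²)` with the constants of `pointwise_cell_inequality`. -/
theorem measure_gainEvent_mul_le {δ : ℝ} (hδ : 0 < δ) {P : Measure (Measure E3)} [IsProbabilityMeasure P]
    (hcore : ∀ᵐ μ ∂P, IsRootedHardCore δ μ) (hstat : IsPointStationaryLaw P) (hE : meanRootEnergy P ≤ eStar)
    (n₀ k : ℕ) {r ε : ℝ} (R' : Fin k → E3) {R₀ c : ℝ} (hR₀ : 0 < R₀) (hc : 0 < c)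
    (hpw : ∀ {L : ℝ}, 0 < L → ∀ {μ : Measure E3}, IsRootedHardCore δ μ →
      ENNReal.ofReal (eStar + Bshift δ) * volume (cube L) +
          ENNReal.ofReal c * cellAvg L (F₃ L R₀ n₀ k r ε R') μ ≤
        cellAvg L (F₁ δ) μ + cellAvg L (F₂ δ L) μ)
    {L : ℝ} (hL : 0 < L) :
    P {μ : Measure E3 | gainCount n₀ k r ε R' μ ≠ 0} * ENNReal.ofReal (c * L ^ 3) ≤
      ENNReal.ofReal ((6 * CT δ + 6 * c * R₀) * L ^ 2) := by
  set E := {μ : Measure E3 | gainCount n₀ k r ε R' μ ≠ 0} with hEdef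
  set Vg := (volume.restrict (cube L)) {u : E3 | R₀ < depth L u} with hVg
  set A := ENNReal.ofReal (eStar + Bshift δ) * volume (cube L) with hA
  have hAtop : A ≠ ∞ := by
    rw [hA, volume_cube hL.le]; exact ENNReal.mul_ne_top ENNReal.ofReal_ne_top ENNReal.ofReal_ne_top
  -- integrate the pointwise inequality
  have hint : A + ENNReal.ofReal c * ∫⁻ μ, cellAvg L (F₃ L R₀ n₀ k r ε R') μ ∂P ≤
      ∫⁻ μ, cellAvg L (F₁ δ) μ ∂P + ∫⁻ μ, cellAvg L (F₂ δ L) μ ∂P := by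
    have h3 := measurable_cellAvg (L := L) (measurable_F₃ L R₀ n₀ k r ε R')
    have h1 := measurable_cellAvg (L := L) (measurable_F₁ δ)
    calc A + ENNReal.ofReal c * ∫⁻ μ, cellAvg L (F₃ L R₀ n₀ k r ε R') μ ∂P
        = ∫⁻ μ, (A + ENNReal.ofReal c * cellAvg L (F₃ L R₀ n₀ k r ε R') μ) ∂P := by
          rw [lintegral_add_left measurable_const, lintegral_const, measure_univ, mul_one,
            lintegral_const_mul _ h3]
      _ ≤ ∫⁻ μ, (cellAvg L (F₁ δ) μ + cellAvg L (F₂ δ L) μ) ∂P :=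
          lintegral_mono_ae (hcore.mono fun μ hμ => hpw hL hμ)
      _ = _ := lintegral_add_left h1 _
  -- evaluate the three expectations
  rw [lintegral_cellAvg_F₁ hL hδ hcore hstat, lintegral_cellAvg_F₂ hL hδ hcore hstat,
    lintegral_cellAvg_F₃ hL hδ hcore hstat] at hint
  have hB1 := lintegral_ofReal_hTilde_le hδ hcore hE
  have hB2 := setLIntegral_F₂_le (δ := δ) hL (0 : Measure E3)
  have hB3 := volume_cube_le_deep_add hL hR₀.le
  -- `A + c P(E) Vg ≤ A + 6L² CT`
  have hkey : ENNReal.ofReal c * (P E * Vg) ≤ ENNReal.ofReal (6 * L ^ 2) * ENNReal.ofReal (CT δ) := by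
    have h' : A + ENNReal.ofReal c * (P E * Vg) ≤ A + ENNReal.ofReal (6 * L ^ 2) * ENNReal.ofReal (CT δ) :=
      calc A + ENNReal.ofReal c * (P E * Vg) ≤ (∫⁻ μ, ENNReal.ofReal (hTilde μ + Bshift δ) ∂P) * volume (cube L) +
            ∫⁻ u in cube L, F₂ δ L (0 : Measure E3) u := hint
        _ ≤ A + ENNReal.ofReal (6 * L ^ 2) * ENNReal.ofReal (CT δ) :=
            add_le_add (mul_le_mul' hB1 le_rfl) hB2
    exact (ENNReal.add_le_add_iff_left hAtop).1 h'
  -- use `vol(cube) ≤ Vg + 6 R₀ L²` and `P(E) ≤ 1`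
  have hPE1 : P E ≤ 1 := prob_le_one
  calc P E * ENNReal.ofReal (c * L ^ 3) = ENNReal.ofReal c * (P E * volume (cube L)) := by
        rw [ENNReal.ofReal_mul hc.le, volume_cube hL.le]; ring
    _ ≤ ENNReal.ofReal c * (P E * (Vg + ENNReal.ofReal (6 * R₀ * L ^ 2))) := by gcongr
    _ = ENNReal.ofReal c * (P E * Vg) + ENNReal.ofReal c * P E * ENNReal.ofReal (6 * R₀ * L ^ 2) := by ring
    _ ≤ ENNReal.ofReal (6 * L ^ 2) * ENNReal.ofReal (CT δ) + ENNReal.ofReal c * 1 * ENNReal.ofReal (6 * R₀ * L ^ 2) := by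
        gcongr
    _ = ENNReal.ofReal ((6 * CT δ + 6 * c * R₀) * L ^ 2) := by
        rw [mul_one, ← ENNReal.ofReal_mul (by positivity), ← ENNReal.ofReal_mul hc.le,
          ← ENNReal.ofReal_add (by have := CT_nonneg δ; positivity) (by positivity)]
        congr 1
        ring

/-- **Every gain event is null.**  Under a minimising point-stationary law on rooted `δ`-hard-core
configurations, `P {μ | gainCount n₀ k r ε R' μ ≠ 0} = 0` for every modification type. -/
theorem measure_gainEvent_eq_zero {δ : ℝ} (hδ : 0 < δ) {P : Measure (Measure E3)} [IsProbabilityMeasure P]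
    (hcore : ∀ᵐ μ ∂P, IsRootedHardCore δ μ) (hstat : IsPointStationaryLaw P) (hE : meanRootEnergy P ≤ eStar)
    (n₀ k : ℕ) {r ε : ℝ} (hr : 0 ≤ r) (hε : 0 < ε) (R' : Fin k → E3) :
    P {μ : Measure E3 | gainCount n₀ k r ε R' μ ≠ 0} = 0 := by
  obtain ⟨R₀, c, hR₀, hc, hpw⟩ := pointwise_cell_inequality hδ n₀ k hr hε R'
  set E := {μ : Measure E3 | gainCount n₀ k r ε R' μ ≠ 0} with hEdef
  by_contra hne
  set p : ℝ := (P E).toReal with hp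
  have hPtop : P E ≠ ∞ := measure_ne_top P E
  have hp0 : 0 < p := ENNReal.toReal_pos hne hPtop
  set K : ℝ := (6 * CT δ + 6 * c * R₀) / c with hK
  have hK0 : 0 ≤ K := by have := CT_nonneg δ; positivity
  set L : ℝ := 2 * K / p + 1 with hLdef
  have hL : 0 < L := by positivity
  have hmain := measure_gainEvent_mul_le hδ hcore hstat hE n₀ k R' hR₀ hc hpw hL
  -- `P(E) ≤ ofReal (K / L)`
  have hdiv : P E ≤ ENNReal.ofReal (K / L) := by
    have hcL : 0 < c * L ^ 3 := by positivity
    have h1 : P E ≤ ENNReal.ofReal ((6 * CT δ + 6 * c * R₀) * L ^ 2) / ENNReal.ofReal (c * L ^ 3) := by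
      rw [ENNReal.le_div_iff_mul_le (Or.inl ((ENNReal.ofReal_pos.2 hcL).ne')) (Or.inl ENNReal.ofReal_ne_top)]
      exact hmain
    rw [← ENNReal.ofReal_div_of_pos hcL] at h1
    have heq : (6 * CT δ + 6 * c * R₀) * L ^ 2 / (c * L ^ 3) = K / L := by
      rw [hK]; field_simp
    rwa [heq] at h1
  -- but `K / L < p`
  have hlt : K / L < p := by
    rw [div_lt_iff₀ hL, hLdef]
    have : K < p * (2 * K / p + 1) := by
      rw [mul_add, mul_div_cancel₀ _ hp0.ne', mul_one]
      linarith
    linarith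
  have : P E < P E :=
    calc P E ≤ ENNReal.ofReal (K / L) := hdiv
      _ < ENNReal.ofReal p := (ENNReal.ofReal_lt_ofReal_iff hp0).2 hlt
      _ = P E := ENNReal.ofReal_toReal hPtop
  exact lt_irrefl _ this

/-- Registered stub marker (helper part 14/14 of `stub_equilibriumInLaw`, line `equilibrium-in-law-surgery`):
every gain event is null under a minimising point-stationary law, `measure_gainEvent_eq_zero`, closed form. -/
theorem stub_equilibriumInLaw_part14 :
    ∀ (δ : ℝ), 0 < δ → ∀ (P : Measure (Measure (EuclideanSpace ℝ (Fin 3)))), IsProbabilityMeasure P →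
      (∀ᵐ μ ∂P, IsRootedHardCore δ μ) → IsPointStationaryLaw P → meanRootEnergy P ≤ eStar →
      ∀ (n₀ k : ℕ) (r ε : ℝ), 0 ≤ r → 0 < ε → ∀ (R' : Fin k → EuclideanSpace ℝ (Fin 3)),
      P {μ : Measure (EuclideanSpace ℝ (Fin 3)) | gainCount n₀ k r ε R' μ ≠ 0} = 0 :=
  fun _ hδ _ _ hcore hstat hE n₀ k _ _ hr hε R' => measure_gainEvent_eq_zero hδ hcore hstat hE n₀ k hr hε R'

end Summit.AtomisticToContinuum.Crystallization.Theorems.PalmUnimodularRigidityMinimiserShells.EquilibriumInLaw.Assembly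

end
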